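import Summits.AtomisticToContinuum.Crystallization.Theorems.FrustratedLawDichotomyBornStability
import Summits.AtomisticToContinuum.Crystallization.Theorems.FrustratedLawDichotomyNoRattlers
import Summits.AtomisticToContinuum.Crystallization.Theorems.FrustratedLawDichotomyAperiodicGapCompressedCut

/-!
# FrustratedLawDichotomy · crux `AperiodicFrustratedLawGap` (stmt-AtomisticToContinuum-27623) — NECESSARY CONDITIONS ON PALM MINIMISERS: omnibus
# (decomp-a2c, prover hand 2, generation 2; API entry point)

One `obtain`-able statement collecting hand 2's landed necessary conditions on an exact Lennard-Jones minimiser among point-stationary hard-core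
laws (`E_P[rootEnergy] ≤ e⋆`, granted the floor of item 9229 as the hypothesis `hU`): mean energy `= e⋆`; VIRIAL `E I₆ = E I₁₂`,
`E[rootEnergy] = −E I₁₂/24`; stability under every `A ∈ GL₃(ℝ)`; ZERO PALM STRESS; BORN STABILITY; almost surely INFINITE (generation 0);
a COMPRESSED neighbour of the root with positive probability; NO RATTLERS (`δR > 10`).  Short vocabulary (`E3`, `eStar`), no route decl.
All `[folklore]`.
-/

noncomputable section

namespace Summit.AtomisticToContinuum.Crystallization.Theorems.FrustratedLawDichotomyVirial

open MeasureTheory Metric Set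
open scoped RealInnerProductSpace
open Literature.MathematicalPhysics.StatisticalMechanics Literature.Probability.Process
open Summit.AtomisticToContinuum.Crystallization.Theorems.ChargedEnergyGapNegative (E3 eStar)
open Summit.AtomisticToContinuum.Crystallization.Theorems.FrustratedLawDichotomyLinearImages (eStar_le_integral_linearDeformed)
open Summit.AtomisticToContinuum.Crystallization.Theorems.FrustratedLawDichotomyPalmStress (palmStress_of_minimising bornStability_of_minimising)
open Summit.AtomisticToContinuum.Crystallization.Theorems.FrustratedLawDichotomyThinning (ae_forall_crowded_of_minimising)
open Summit.AtomisticToContinuum.Crystallization.Theorems.FrustratedLawDichotomyAperiodicGapFiniteCut (ae_infinite_of_minimising)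
open Summit.AtomisticToContinuum.Crystallization.Theorems.FrustratedLawDichotomyAperiodicGapVirialCut (compressedRoot_of_minimising)

/-- **NECESSARY CONDITIONS ON PALM MINIMISERS (hand 2, generations 0 and 2).**  Granted the energy floor for point-stationary hard-core
probability laws (item 9229, hypothesis `hU`), a point-stationary `δ`-hard-core probability law `P` with `E_P[rootEnergy] ≤ e⋆` satisfies:
(1) `E_P[rootEnergy] = e⋆`; (2) the virial identity `∫∫‖y‖⁻⁶ = ∫∫‖y‖⁻¹²` and (3) `E_P[rootEnergy] = −(1/24)∫∫‖y‖⁻¹²`; (4) stability under every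
linear automorphism of `ℝ³`; (5) zero Palm stress tensor; (6) Born stability; (7) almost surely infinitely many atoms; (8) the root has a
neighbour at distance `< 1` with positive probability; (9) no rattlers: for `R ≥ δ` with `δR > 10`, almost surely every atom has another atom
within distance `R`. [folklore] -/
theorem minimiser_necessary_conditions
    (hU : ∀ δ' : ℝ, 0 < δ' → ∀ Q : Measure (Measure E3), IsProbabilityMeasure Q → (∀ᵐ μ ∂Q, IsRootedHardCore δ' μ) →
      IsPointStationaryLaw Q → eStar ≤ ∫ μ, rootEnergy lennardJones μ ∂Q)
    {δ : ℝ} (hδ : 0 < δ) {P : Measure (Measure E3)} [IsProbabilityMeasure P] (hcore : ∀ᵐ μ ∂P, IsRootedHardCore δ μ)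
    (hstat : IsPointStationaryLaw P) (hmin : ∫ μ, rootEnergy lennardJones μ ∂P ≤ eStar) :
    (∫ μ, rootEnergy lennardJones μ ∂P = eStar) ∧
    (∫ μ, ∫ y, ‖y‖⁻¹ ^ 6 ∂μ ∂P = ∫ μ, ∫ y, ‖y‖⁻¹ ^ 12 ∂μ ∂P) ∧
    (∫ μ, rootEnergy lennardJones μ ∂P = -(1 / 24) * ∫ μ, ∫ y, ‖y‖⁻¹ ^ 12 ∂μ ∂P) ∧
    (∀ A : E3 ≃L[ℝ] E3, ∫ μ, rootEnergy lennardJones μ ∂P ≤ ∫ μ, (∫ y, lennardJones ‖A y‖ ∂μ) / 2 ∂P) ∧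
    (∀ H : E3 →L[ℝ] E3, ∫ μ, ∫ s, (‖s‖⁻¹ ^ 8 - ‖s‖⁻¹ ^ 14) * ⟪s, H s⟫ ∂μ ∂P = 0) ∧
    (∀ H : E3 →L[ℝ] E3,
      0 ≤ ∫ μ, ∫ s, (14 * ‖s‖⁻¹ ^ 16 - 8 * ‖s‖⁻¹ ^ 10) * ⟪s, H s⟫ ^ 2 + (‖s‖⁻¹ ^ 8 - ‖s‖⁻¹ ^ 14) * ‖H s‖ ^ 2 ∂μ ∂P) ∧
    (∀ᵐ μ ∂P, {p : E3 | μ {p} ≠ 0}.Infinite) ∧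
    (¬ ∀ᵐ μ ∂P, ∀ s : E3, μ {s} ≠ 0 → s ≠ 0 → 1 ≤ ‖s‖) ∧
    (∀ R : ℝ, δ ≤ R → 10 < δ * R → ∀ᵐ μ ∂P, ∀ y : E3, μ {y} ≠ 0 → 1 < μ (closedBall y R)) := by
  obtain ⟨hvir, hE, heq⟩ := virial_of_minimising' hU hδ hcore hstat hmin
  exact ⟨heq, hvir, hE, fun A => hmin.trans (eStar_le_integral_linearDeformed hU hδ hcore hstat A),
    fun H => palmStress_of_minimising hU hδ hcore hstat hmin H, fun H => bornStability_of_minimising hU hδ hcore hstat hmin H,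
    ae_infinite_of_minimising hU hδ hcore hstat hmin, compressedRoot_of_minimising hU hδ hcore hstat hmin,
    fun R hδR hR => ae_forall_crowded_of_minimising hU hδ hcore hstat hmin hδR hR⟩

end Summit.AtomisticToContinuum.Crystallization.Theorems.FrustratedLawDichotomyVirial

end
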